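import Literature.Computability.AlgebraicComplexity.GenericTrivialStabilizerAllFields
import Literature.Computability.AlgebraicComplexity.ZariskiClosureBaseChange
import Mathlib.FieldTheory.IsAlgClosed.AlgebraicClosure
import Mathlib.RingTheory.Ideal.GoingUp
import HarnessLib

/-!
# Hypersurfaces without linear automorphisms over every field of characteristic `0`
# (Poonen 2005, Thm. 4 in characteristic `0`; Thm. 3 ⇒ Thm. 4 over every infinite field)

Topic `Literature/Computability/AlgebraicComplexity` (cell `val-lit`, row X3-Poonen05). Theorems only —
no definition, no named fact.

Poonen, *Varieties without extra automorphisms III: hypersurfaces*, FFA 11 (2005), Thm. 4 (p0002:L23):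
"For any field `k` and integers `n ≥ 1`, `d ≥ 3` with `(n, d) ≠ (1, 3)`, there exists a smooth
hypersurface `X` over `k` of degree `d` in `ℙ^{n+1}` such that `Lin X = {1}`." The tree's named fact
`poonen2005_thm_4` (`Poonen05HypersurfaceLinearAutomorphisms.lean`) quantifies over EVERY field; the
paper proves it by the explicit forms of its Table 1 (five cases by `d mod p`), and remarks (p0002:L22)
that for INFINITE fields it already follows from Thm. 3 ("Combining Theorem 3 with the Lang–Weil
method … for any field `k` with `#k > N_{n,d}` (in particular, any infinite field), there exists …").
This file formalises that remark in its elementary form and combines it with the characteristic-`0`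
case of Thm. 3 (`GenericTrivialStabilizerAllFields.poonen2005_thm_3_of_charZero`):

* § 1 `exists_eval_algebraMap_ne_zero`, `IsZariskiGeneric.exists_form_map` — **a non-zero polynomial
  over an extension `K ⊇ k` of an infinite field `k` does not vanish at some `k`-rational point**
  (decompose along a `k`-basis of `K`, tree `ZariskiClosureBaseChange.eq_sum_basisComponent`, and use
  that a polynomial over an infinite field vanishing everywhere is zero); hence a Zariski-generic
  property of degree-`D` forms over `K` holds for the base change of SOME form over `k`.
* § 2 `isNonsingularForm_of_map_algebraMap` — **nonsingularity descends along algebraic extensions**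
  (a prime of `k[x]` containing `F` and its partials lies under a prime of `K[x]`, lying-over for the
  integral extension `k[x] ⊆ K[x]`, Mathlib `Ideal.exists_ideal_over_prime_of_isIntegral`; the
  ascent is the tree's `IsNonsingularForm.map`, `AlgebraicGeometry/Motives/UniversalHypersurfaceFibre`).
* § 3 `poonen2005_thm_4_of_thm_3_of_infinite` — **Thm. 3 ⇒ Thm. 4 for every infinite field** (the
  fact `poonen2005_thm_3` as hypothesis, the body of `poonen2005_thm_4` at an infinite `k` as
  conclusion), and **`poonen2005_thm_4_of_charZero`** — the body of the fact `poonen2005_thm_4`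
  VERBATIM at every field `k` of characteristic `0`, PROVED (from `poonen2005_thm_3_of_charZero`
  over `k̄ = AlgebraicClosure k`, unconditionally).

Typed vs printed / what stays open. `poonen2005_thm_4` itself (EVERY field — finite fields and
infinite fields of positive characteristic) is NOT discharged and stays OPEN BY NAME: finite fields
need the paper's explicit forms (Table 1, §§2–8), and infinite fields of characteristic `p` need
Thm. 3 in characteristic `p` (open in the tree: the unipotent residue, see
`GenericTrivialStabilizerAllFields`). Honest framing: typed ≠ endorsed; nothing here bears on VP
versus VNP, which is NOT proved.

## References

* B. Poonen, *Varieties without extra automorphisms III: hypersurfaces*, Finite Fields Appl. 11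
  (2005) 230–268, Thm. 3, Thm. 4 and the remark between them (p0002:L19–23, held text
  `paper:doi-10-1016-j-ffa-2004-12-001`). [Poonen2005]
* J. S. Milne, *Algebraic Groups*, CUP 2017, Prop. 1.11 (schematic density under base field
  extension; the basis decomposition). [Milne2017AlgebraicGroups]
* M. F. Atiyah, I. G. Macdonald, *Introduction to Commutative Algebra*, Thm. 5.10 (lying over).
  [AtiyahMacdonald1969]

## Tree

`IsZariskiGeneric`, `formCoeff`, `DegIdx` (`BI17FundamentalInvariantForms`, `OrbitCoordinateRing`);
`HasTrivialLinAut`, `poonen2005_thm_3`, `poonen2005_thm_4` (`Poonen05HypersurfaceLinearAutomorphisms`);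
`poonen2005_thm_3_of_charZero` (`GenericTrivialStabilizerAllFields`); `basisComponent`,
`eq_sum_basisComponent`, `eval_basisComponent_eq_zero` (`ZariskiClosureBaseChange`);
`IsNonsingularForm` (`AlgebraicGeometry/Motives/HypersurfaceFormsNonsingular`).

## Provenance

Cell `val-lit`, seat `val-lit-x3` generation 8 (cross-ladder literature seat; row X3 residue).
-/

noncomputable section

open MvPolynomial

namespace Literature.Computability.AlgebraicComplexity

open _root_.Literature.AlgebraicGeometry.Motives.SmoothHypersurface

/-! ### § 1 Rational points off a hypersurface defined over an extension field -/

section RationalPoints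

variable {k K : Type*} [Field k] [Field K] [Algebra k K]

/-- **A non-zero polynomial over an extension `K` of an infinite field `k` is non-zero at some
`k`-rational point.** Decompose `P = Σ_j b_j · (P_j)_K` along a `k`-basis `b` of `K`
(`eq_sum_basisComponent`); if `P` vanished at every `k`-point, so would every `P_j`
(`eval_basisComponent_eq_zero`), hence `P_j = 0` (`k` infinite) and `P = 0`.
[cite: Milne2017AlgebraicGroups, Prop. 1.11 (proof)] -/
theorem exists_eval_algebraMap_ne_zero [Infinite k] {τ : Type*} {P : MvPolynomial τ K}
    (hP : P ≠ 0) : ∃ y : τ → k, eval (fun t => algebraMap k K (y t)) P ≠ 0 := by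
  classical
  by_contra! hall
  apply hP
  let b := Module.Free.chooseBasis k K
  rw [eq_sum_basisComponent b P]
  refine Finset.sum_eq_zero fun j _ => ?_
  have hj : basisComponent b j P = 0 :=
    MvPolynomial.funext fun y => by
      rw [map_zero]
      exact eval_basisComponent_eq_zero b (hall y) j
  rw [hj, map_zero, mul_zero]

variable {σ : Type*} [Fintype σ] [DecidableEq σ]

/-- Every coefficient vector of `Sym^D k^σ` is that of a form of degree `D` (local copy of the tree's
`exists_isHomogeneous_formCoeff_eq`, which carries a `LinearOrder σ`). [folklore] -/
private theorem exists_isHomogeneous_formCoeff_eq_aux {D : ℕ} (c : DegIdx σ D → k) :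
    ∃ p : MvPolynomial σ k, p.IsHomogeneous D ∧ formCoeff D p = c := by
  classical
  refine ⟨∑ d : DegIdx σ D, monomial d.1 (c d), ?_, ?_⟩
  · exact IsHomogeneous.sum _ _ _ fun d _ =>
      isHomogeneous_monomial (R := k) (d := d.1) (n := D) (c d) (mem_degMonomials_iff.mp d.2)
  · funext d
    rw [formCoeff_apply, coeff_sum]
    simp only [coeff_monomial]
    rw [Finset.sum_eq_single d (fun e _ hne => if_neg fun h => hne (Subtype.ext h))
      (fun h => absurd (Finset.mem_univ d) h), if_pos rfl]

/-- **A Zariski-generic property of forms over `K` holds for the base change of some form over an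
infinite subfield `k`**: the test polynomial is non-zero at a `k`-rational coefficient vector
(`exists_eval_algebraMap_ne_zero`), which is the coefficient vector of `f_K` for a form `f` over
`k`. (The elementary content of Poonen's remark after Thm. 3: over an infinite field a generic
property is witnessed by a rational hypersurface.) [cite: Poonen2005, Thm. 3 (remark following, p. 231)] -/
theorem IsZariskiGeneric.exists_form_map [Infinite k] {D : ℕ} {P : MvPolynomial σ K → Prop}
    (h : IsZariskiGeneric D P) :
    ∃ f : MvPolynomial σ k, f.IsHomogeneous D ∧ P (MvPolynomial.map (algebraMap k K) f) := by
  obtain ⟨F, hF0, hF⟩ := h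
  obtain ⟨y, hy⟩ := exists_eval_algebraMap_ne_zero (k := k) hF0
  obtain ⟨f, hf, hfy⟩ := exists_isHomogeneous_formCoeff_eq_aux (k := k) y
  refine ⟨f, hf, hF _ (hf.map _) ?_⟩
  have hc : formCoeff D (MvPolynomial.map (algebraMap k K) f) = fun t => algebraMap k K (y t) := by
    funext d
    rw [formCoeff_apply, coeff_map, ← formCoeff_apply, hfy]
  rw [hc]
  exact fun h => hy (by rw [← coe_aeval_eq_eval]; exact h)

end RationalPoints

/-! ### § 2 Nonsingularity descends along algebraic extensions -/

section Descent

variable {k K : Type*} [Field k] [Field K] [Algebra k K] {n : ℕ}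

/-- **Nonsingularity descends along an algebraic extension `K ⊇ k`**: if `F_K` is nonsingular then
so is `F`. A prime `𝔭 ⊂ k[x]` containing `F` and its partials lies under a prime `𝔓 ⊂ K[x]` (lying
over: `K[x]` is integral over `k[x]` because `K` is algebraic over `k`); `𝔓` contains `F_K` and its
partials `(∂ⱼF)_K = ∂ⱼ(F_K)`, hence all `xᵢ`, and so does `𝔭 = 𝔓 ∩ k[x]`.
[cite: AtiyahMacdonald1969, Thm. 5.10 (lying over)] -/
theorem isNonsingularForm_of_map_algebraMap [Algebra.IsAlgebraic k K]
    {F : MvPolynomial (Fin (n + 2)) k}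
    (h : IsNonsingularForm K (MvPolynomial.map (algebraMap k K) F)) : IsNonsingularForm k F := by
  intro 𝔭 h𝔭 hF𝔭 hder i
  letI alg : Algebra (MvPolynomial (Fin (n + 2)) k) (MvPolynomial (Fin (n + 2)) K) :=
    (MvPolynomial.map (algebraMap k K)).toAlgebra
  have halg : algebraMap (MvPolynomial (Fin (n + 2)) k) (MvPolynomial (Fin (n + 2)) K) =
      MvPolynomial.map (algebraMap k K) := rfl
  haveI : IsScalarTower k (MvPolynomial (Fin (n + 2)) k) (MvPolynomial (Fin (n + 2)) K) :=
    IsScalarTower.of_algebraMap_eq fun a => by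
      rw [halg, MvPolynomial.algebraMap_eq, MvPolynomial.algebraMap_apply, map_C]
  haveI : Algebra.IsIntegral (MvPolynomial (Fin (n + 2)) k) (MvPolynomial (Fin (n + 2)) K) := by
    refine ⟨fun q => MvPolynomial.induction_on q (fun a => ?_) (fun p q hp hq => hp.add hq)
      (fun p j hp => hp.mul ?_)⟩
    · have ha : IsIntegral k a := (Algebra.IsAlgebraic.isAlgebraic a).isIntegral
      have h1 : IsIntegral k (C a : MvPolynomial (Fin (n + 2)) K) := by
        have := ha.map (IsScalarTower.toAlgHom k K (MvPolynomial (Fin (n + 2)) K))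
        rwa [IsScalarTower.coe_toAlgHom', MvPolynomial.algebraMap_eq] at this
      exact h1.tower_top
    · have hX : (X j : MvPolynomial (Fin (n + 2)) K) =
          algebraMap (MvPolynomial (Fin (n + 2)) k) (MvPolynomial (Fin (n + 2)) K) (X j) := by
        rw [halg, map_X]
      rw [hX]
      exact isIntegral_algebraMap
  have hker : (⊥ : Ideal (MvPolynomial (Fin (n + 2)) K)).comap
      (algebraMap (MvPolynomial (Fin (n + 2)) k) (MvPolynomial (Fin (n + 2)) K)) ≤ 𝔭 := by
    rw [Ideal.comap_bot_of_injective _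
      (by rw [halg]; exact map_injective _ (algebraMap k K).injective)]
    exact bot_le
  haveI := h𝔭
  obtain ⟨𝔓, -, h𝔓, hcomap⟩ := Ideal.exists_ideal_over_prime_of_isIntegral 𝔭 ⊥ hker
  have hmem : ∀ g : MvPolynomial (Fin (n + 2)) k,
      g ∈ 𝔭 ↔ MvPolynomial.map (algebraMap k K) g ∈ 𝔓 := fun g => by
    rw [← hcomap, Ideal.mem_comap, halg]
  have hX := h 𝔓 h𝔓 ((hmem F).mp hF𝔭) (fun j => by
    rw [pderiv_map]
    exact (hmem _).mp (hder j)) i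
  rw [hmem, map_X]
  exact hX

end Descent

/-! ### § 3 Poonen 2005, Thm. 4: infinite fields from Thm. 3; characteristic `0` unconditionally -/

section Thm4

/-- **Thm. 3 ⇒ Thm. 4 over every INFINITE field** (Poonen's remark before Thm. 4, p0002:L22, in its
elementary form — no Lang–Weil needed when `k` is infinite): if the generic hypersurface of degree
`d` in `ℙ^{n+1}` over `k̄` is smooth with `Lin = {1}` (the fact `poonen2005_thm_3` at
`K = AlgebraicClosure k`), then some hypersurface DEFINED OVER `k` is (the conclusion is the body of
the fact `poonen2005_thm_4` at `k`): a rational point off the bad hypersurface of coefficient space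
(§ 1) and descent of smoothness (§ 2). [cite: Poonen2005, Thm. 4 (and the remark preceding it)] -/
theorem poonen2005_thm_4_of_thm_3_of_infinite (h3 : poonen2005_thm_3) (k : Type) [Field k]
    [Infinite k] (n d : ℕ) (hn : 1 ≤ n) (hd : 3 ≤ d) (hnd : (n, d) ≠ (1, 3)) :
    ∃ f : MvPolynomial (Fin (n + 2)) k, f.IsHomogeneous d ∧ IsNonsingularForm k f ∧
      HasTrivialLinAut (MvPolynomial.map (algebraMap k (AlgebraicClosure k)) f) := by
  obtain ⟨f, hf, hns, hlin⟩ := (h3 (AlgebraicClosure k) n d hn hd hnd).exists_form_map (k := k)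
  exact ⟨f, hf, isNonsingularForm_of_map_algebraMap hns, hlin⟩

/-- **Poonen 2005, Thm. 4 — every field of CHARACTERISTIC `0`, PROVED** (the body of the tree's fact
`poonen2005_thm_4` at `k`, verbatim, plus the one hypothesis `[CharZero k]`): for `n ≥ 1`, `d ≥ 3`,
`(n,d) ≠ (1,3)` there is a smooth hypersurface of degree `d` in `ℙ^{n+1}` over `k` with `Lin X = {1}`
over `k̄`. From `poonen2005_thm_3_of_charZero` over `K = AlgebraicClosure k` (characteristic `0`,
algebraically closed), a `k`-rational coefficient vector off the bad locus (§ 1; `k` is infinite) and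
descent of smoothness (§ 2). The paper's own proof (explicit forms, Table 1) is not formalised; the
fact for finite fields and for infinite fields of positive characteristic stays OPEN BY NAME.
[cite: Poonen2005, Thm. 4] -/
theorem poonen2005_thm_4_of_charZero (k : Type*) [Field k] [CharZero k] (n d : ℕ) (hn : 1 ≤ n)
    (hd : 3 ≤ d) (hnd : (n, d) ≠ (1, 3)) :
    ∃ f : MvPolynomial (Fin (n + 2)) k, f.IsHomogeneous d ∧ IsNonsingularForm k f ∧
      HasTrivialLinAut (MvPolynomial.map (algebraMap k (AlgebraicClosure k)) f) := by
  haveI : Infinite k := Infinite.of_injective _ Nat.cast_injective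
  haveI : CharZero (AlgebraicClosure k) :=
    charZero_of_injective_algebraMap (algebraMap k (AlgebraicClosure k)).injective
  obtain ⟨f, hf, hns, hlin⟩ :=
    (poonen2005_thm_3_of_charZero (AlgebraicClosure k) n d hn hd hnd).exists_form_map (k := k)
  exact ⟨f, hf, isNonsingularForm_of_map_algebraMap hns, hlin⟩

/-- The statement of `poonen2005_thm_4` restricted to characteristic `0`, in the fact's own binder
shape (`∀ k, [Field k] → …` with `[CharZero k]` added): a one-line re-export of
`poonen2005_thm_4_of_charZero` for by-name consumers. [cite: Poonen2005, Thm. 4] -/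
theorem poonen2005_thm_4_charZero :
    ∀ (k : Type) [Field k] [CharZero k] (n d : ℕ), 1 ≤ n → 3 ≤ d → (n, d) ≠ (1, 3) →
      ∃ f : MvPolynomial (Fin (n + 2)) k, f.IsHomogeneous d ∧ IsNonsingularForm k f ∧
        HasTrivialLinAut (MvPolynomial.map (algebraMap k (AlgebraicClosure k)) f) :=
  fun k _ _ n d hn hd hnd => poonen2005_thm_4_of_charZero k n d hn hd hnd

end Thm4

end Literature.Computability.AlgebraicComplexity

end
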